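import Literature.Analysis.FluidPDE.KatoLaiSymOperator
import Literature.Analysis.FluidPDE.KatoLaiCanonicalTriplet
import Literature.Analysis.FluidPDE.KatoLaiAbstractEvolutionProofs
import HarnessLib

/-!
# Kato–Lai's operator in duality form on `SymL2`: coercivity, weak continuity, and the run of Thm A

Analysis/FluidPDE support file for the energy-method construction of Euler flows in the
periodic cylinder (`Literature.Analysis.FluidPDE.KatoLai1984_periodicCylinderUniformExistence`;
Kato–Lai 1984, §5 (5.1)–(5.6) "verification of the hypotheses of Theorem A" and §3 Thm A).
With `H = V = SymL2 (Fin 3)` at the compressed weight `w = klWeight s ε`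
(`KatoLaiSymOperator`), the inclusion `i = diag w⁻¹ : V → H` (injective, dense range: the
canonical triplet of `KatoLaiCanonicalTriplet`) and the operator in duality form
`B f v = ⟪𝒜̂ f, v⟫` (`klForm`):

* `hasSum_pure_re_inner` — Plancherel for pure derivatives of two smooth real fields;
* `inner_toL2_klOp_eq_pairing` — for a finitely supported `v` with physical field `Ũ` of `i v`,
  `⟪toL2 (klOp Ũ), v⟫ = P₃(Ũ) + ε² P_s(Ũ)`, `P_m` the pairing of `KatoLaiTorusOperator`;
* `exists_coercive_klForm` — **(5.5)**: `|B (i v) v| ≤ K (‖i v‖²)^{3/2}`, hence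
  `-β(‖i v‖²) ≤ B (i v) v` with `β r = K (r⁺ + 1)²`, `K = K(L, s)` independent of `ε ∈ ℝ`;
* `isSeqWeaklyContinuousFormOn_klForm` — from (E3) of `KatoLaiSymOperator`;
* `exists_formSolution_klForm` — **the run of Theorem A** (`KatoLai1984_thmA_holds`, supersolution
  form, affine supersolution): for `‖φ‖² ≤ M'` a solution in duality form on `[0, T]` with
  `T = (2 K (M' + 2)² + 1)⁻¹` depending only on `L, s, M'`, and `‖u t‖² ≤ M' + 1`.

Everything is proved; no named fact and no `sorry` is introduced.

## References

* T. Kato, C. Y. Lai, J. Funct. Anal. 56 (1984) 15–28, §3 Thm A, §5. [KatoLai1984]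
-/

noncomputable section

open MeasureTheory Set Function Filter Topology TopologicalSpace Finset
open scoped NNReal ENNReal InnerProductSpace RealInnerProductSpace

namespace Literature.Analysis.FluidPDE

open FunctionSpaces FunctionSpaces.Torus UnitAddTorus

/-- Local notation for physical space `ℝ³ = EuclideanSpace ℝ (Fin 3)`. -/
local notation "ℝ³" => EuclideanSpace ℝ (Fin 3)

namespace PeriodicCylinder

/-! ### Plancherel for pure derivatives of two fields -/

/-- **Plancherel for pure word derivatives**: `∑_k ((2π|kᵢ|)^m)² Re ⟪â k, û k⟫ = ∫ ⟪∂ᵢ^m a, ∂ᵢ^m u⟫`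
(word form). [cite: Grafakos2014, Prop. 3.2.7] -/
theorem hasSum_pure_re_inner_wordDeriv {a u : UnitAddTorus (Fin 3) → ℝ³} (ha : IsSmooth a) (hu : IsSmooth u) (i : Fin 3) (m : ℕ) :
    HasSum (fun k : Fin 3 → ℤ => ((2 * Real.pi * |(k i : ℝ)|) ^ m) ^ 2 *
        RCLike.re ⟪mFourierCoeff (EuclideanSpace.complexify ∘ a) k, mFourierCoeff (EuclideanSpace.complexify ∘ u) k⟫_ℂ)
      (∫ x, ⟪Torus.wordDeriv (List.replicate m i) a x, Torus.wordDeriv (List.replicate m i) u x⟫_ℝ) := by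
  have ham := Torus.isSmooth_wordDeriv ha (List.replicate m i)
  have hum := Torus.isSmooth_wordDeriv hu (List.replicate m i)
  have h := hasSum_re_inner_mFourierCoeff_complexify (d := Fin 3)
    (ham.continuous.memLp_of_hasCompactSupport (HasCompactSupport.of_compactSpace _))
    (hum.continuous.memLp_of_hasCompactSupport (HasCompactSupport.of_compactSpace _))
  refine h.congr_fun fun k => ?_
  rw [Torus.mFourierCoeff_complexify_wordDeriv ha k, Torus.mFourierCoeff_complexify_wordDeriv hu k,
    inner_smul_left, inner_smul_right, ← mul_assoc, Complex.conj_mul']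
  have hσ : ‖Torus.wordSymbol (List.replicate m i) k‖ = (2 * Real.pi * |(k i : ℝ)|) ^ m := by
    have h1 : ‖(2 * Real.pi * Complex.I * (k i : ℂ))‖ = 2 * Real.pi * |(k i : ℝ)| := by
      simp only [norm_mul, Complex.norm_ofNat, Complex.norm_real, Real.norm_eq_abs, Complex.norm_I, mul_one,
        Complex.norm_intCast, abs_of_pos Real.pi_pos]
    have : Torus.wordSymbol (List.replicate m i) k = (2 * Real.pi * Complex.I * (k i : ℂ)) ^ m := by
      simp [Torus.wordSymbol, List.map_replicate, List.prod_replicate]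
    rw [this, norm_pow, h1]
  rw [hσ, show (((2 * Real.pi * |(k i : ℝ)|) ^ m : ℝ) : ℂ) ^ 2 = ((((2 * Real.pi * |(k i : ℝ)|) ^ m) ^ 2 : ℝ) : ℂ) by push_cast; ring,
    Complex.re_ofReal_mul]
  rfl

/-- **Plancherel for pure derivatives** (iterate form). [cite: Grafakos2014, Prop. 3.2.7] -/
theorem hasSum_pure_re_inner {a u : UnitAddTorus (Fin 3) → ℝ³} (ha : IsSmooth a) (hu : IsSmooth u) (i : Fin 3) (m : ℕ) :
    HasSum (fun k : Fin 3 → ℤ => ((2 * Real.pi * |(k i : ℝ)|) ^ m) ^ 2 *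
        RCLike.re ⟪mFourierCoeff (EuclideanSpace.complexify ∘ a) k, mFourierCoeff (EuclideanSpace.complexify ∘ u) k⟫_ℂ)
      (∫ x, ⟪(Torus.partialDeriv i)^[m] a x, (Torus.partialDeriv i)^[m] u x⟫_ℝ) := by
  have h := hasSum_pure_re_inner_wordDeriv ha hu i m
  simp only [Torus.wordDeriv_replicate] at h
  exact h

/-- **Plancherel**: `∑_k Re ⟪â k, û k⟫ = ∫ ⟪a, u⟫`. [cite: Grafakos2014, Prop. 3.2.7] -/
theorem hasSum_re_inner {a u : UnitAddTorus (Fin 3) → ℝ³} (ha : IsSmooth a) (hu : IsSmooth u) :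
    HasSum (fun k : Fin 3 → ℤ =>
        RCLike.re ⟪mFourierCoeff (EuclideanSpace.complexify ∘ a) k, mFourierCoeff (EuclideanSpace.complexify ∘ u) k⟫_ℂ)
      (∫ x, ⟪a x, u x⟫_ℝ) := by
  have h := hasSum_pure_re_inner ha hu 0 0
  simpa using h

/-- **Plancherel at the pure weight of level `m`**:
`∑_k pureSq m k · Re ⟪â k, û k⟫ = ∫⟪a, u⟫ + ∑ᵢ ∫⟪∂ᵢ^m a, ∂ᵢ^m u⟫`. [folklore] -/
theorem hasSum_pureSq_mul_re_inner {a u : UnitAddTorus (Fin 3) → ℝ³} (ha : IsSmooth a) (hu : IsSmooth u) (m : ℕ) :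
    HasSum (fun k : Fin 3 → ℤ => pureSq m k *
        RCLike.re ⟪mFourierCoeff (EuclideanSpace.complexify ∘ a) k, mFourierCoeff (EuclideanSpace.complexify ∘ u) k⟫_ℂ)
      ((∫ x, ⟪a x, u x⟫_ℝ) + ∑ i, ∫ x, ⟪(Torus.partialDeriv i)^[m] a x, (Torus.partialDeriv i)^[m] u x⟫_ℝ) := by
  have h0 := hasSum_re_inner ha hu
  have h1 := hasSum_sum (s := (univ : Finset (Fin 3))) fun i _ => hasSum_pure_re_inner ha hu i m
  convert h0.add h1 using 1
  funext k
  rw [pureSq, add_mul, one_mul, sum_mul]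

/-! ### The inclusion and the form -/

section Form

variable {L : ℝ} (hL : 0 < L) (s : ℕ) (ε : ℝ)

/-- `|w⁻¹| ≤ 1`. [folklore] -/
theorem abs_klWeight_inv_le (k : Fin 3 → ℤ) : |(klWeight s ε k)⁻¹| ≤ 1 := by
  rw [abs_of_pos (inv_pos.2 (klWeight_pos s ε k))]
  exact inv_le_one_of_one_le₀ (one_le_klWeight s ε k)

/-- `w⁻¹` is even. [folklore] -/
theorem klWeight_inv_neg (k : Fin 3 → ℤ) : (klWeight s ε (-k))⁻¹ = (klWeight s ε k)⁻¹ := by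
  rw [(isWeight_klWeight s ε).even]

/-- **The inclusion `i : V → H`** of the canonical triplet: `diag w⁻¹`. [cite: KatoLai1984, §5 (5.1)] -/
def embed : SymL2 (Fin 3) →L[ℝ] SymL2 (Fin 3) :=
  SymL2.diag (fun k => (klWeight s ε k)⁻¹) (abs_klWeight_inv_le s ε) (klWeight_inv_neg s ε)

/-- Coordinates of `embed v`. [folklore] -/
theorem embed_apply (v : SymL2 (Fin 3)) (k : Fin 3 → ℤ) : embed s ε v k = ((klWeight s ε k)⁻¹ : ℂ) • v k := by
  rw [embed, SymL2.diag_apply]; norm_cast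

/-- `embed` is injective. [folklore] -/
theorem embed_injective : Function.Injective (embed s ε) :=
  SymL2.diag_injective (abs_klWeight_inv_le s ε) (klWeight_inv_neg s ε) fun k => (inv_pos.2 (klWeight_pos s ε k)).ne'

/-- `embed` has dense range. [folklore] -/
theorem denseRange_embed : DenseRange (embed s ε) :=
  SymL2.denseRange_diag (abs_klWeight_inv_le s ε) (klWeight_inv_neg s ε) fun k => (inv_pos.2 (klWeight_pos s ε k)).ne'

/-- `embed` commutes with truncation. [folklore] -/
theorem embed_trunc (N : ℕ) (v : SymL2 (Fin 3)) : embed s ε (SymL2.trunc N v) = SymL2.trunc N (embed s ε v) := by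
  refine SymL2.ext fun k => ?_
  simp only [embed_apply, SymL2.trunc_apply]
  split_ifs <;> simp

/-- **The operator in duality form**: `B t f v = ⟪𝒜̂ f, v⟫`. [cite: KatoLai1984, §5 (5.6)] -/
def klForm (_t : ℝ) (f : SymL2 (Fin 3)) : SymL2 (Fin 3) →L[ℝ] ℝ := innerSL ℝ (klOpExt hL s ε f)

/-- Unfolding. [folklore] -/
theorem klForm_apply (t : ℝ) (f v : SymL2 (Fin 3)) : klForm hL s ε t f v = ⟪klOpExt hL s ε f, v⟫_ℝ := rfl

/-- **Weak sequential continuity of the form.** [cite: KatoLai1984, §5] -/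
theorem isSeqWeaklyContinuousFormOn_klForm (S : Set ℝ) : KatoLai.IsSeqWeaklyContinuousFormOn S (klForm hL s ε) := by
  refine KatoLai.isSeqWeaklyContinuousFormOn_const fun w w' hw v => ?_
  have ht := tendsto_klOpExt_of_weakTendsto hL s ε (f := w) (g := w') hw
  show Tendsto (fun n => ⟪klOpExt hL s ε (w n), v⟫_ℝ) atTop (𝓝 ⟪klOpExt hL s ε w', v⟫_ℝ)
  exact ht.inner tendsto_const_nhds

/-! ### The pairing identity for finitely supported test elements -/

/-- Truncation is idempotent. [folklore] -/
theorem trunc_trunc (N : ℕ) (v : SymL2 (Fin 3)) : SymL2.trunc N (SymL2.trunc N v) = SymL2.trunc N v := by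
  refine SymL2.ext fun k => ?_
  simp only [SymL2.trunc_apply]
  split_ifs <;> rfl

/-- `ε² lat_s(U) ≤ 4^{s-1} ‖toSym U‖²` for `s ≥ 1`. [folklore] -/
theorem sq_mul_latNormSq_le_norm_toSym_sq {s : ℕ} (hs : 1 ≤ s) (ε : ℝ) {U : UnitAddTorus (Fin 3) → ℝ³} (hU : IsSmooth U) :
    ε ^ 2 * Torus.latNormSq s U ≤ 4 ^ (s - 1) * ‖toSym s ε hU‖ ^ 2 := by
  have h := SymL2.hasSum_norm_sq_ofSmooth (isWeight_klWeight s ε) (polyGrowth_klWeight s ε) hU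
  unfold Torus.latNormSq
  rw [← (h.mul_left (4 ^ (s - 1))).tsum_eq, ← tsum_mul_left]
  refine ((Torus.summable_latWeight hU s).mul_left _).tsum_le_tsum (fun k => ?_) ((h.mul_left _).summable)
  rw [← mul_assoc, ← mul_assoc]
  exact mul_le_mul_of_nonneg_right (sq_mul_latWeight_le_klWeight_sq hs ε k) (sq_nonneg _)

/-- For `v = trunc N v`: `toSym (truncField N (embed v)) = embed v`. [folklore] -/
theorem toSym_truncField_embed {N : ℕ} {v : SymL2 (Fin 3)} (hv : SymL2.trunc N v = v) :
    toSym s ε (isSmooth_truncField s ε N (embed s ε v)) = embed s ε v := by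
  rw [toSym_truncField, ← embed_trunc, hv]

/-- **The pairing identity**: for `v = trunc N v` with physical field `Ũ = truncField N (embed v)`,
`⟪toL2 (klOp Ũ), v⟫ = P₃(Ũ) + ε² P_s(Ũ)`. [cite: KatoLai1984, §5 (5.2), (5.6)] -/
theorem inner_toL2_klOp_eq_pairing {N : ℕ} {v : SymL2 (Fin 3)} (hv : SymL2.trunc N v = v) :
    ⟪toL2 (isSmooth_klOp hL (isSmooth_truncField s ε N (embed s ε v))), v⟫_ℝ =
      ((∫ ξ, ⟪klOp L hL (isSmooth_truncField s ε N (embed s ε v)) ξ, truncField s ε N (embed s ε v) ξ⟫_ℝ) +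
        ∑ i, ∫ ξ, ⟪(Torus.partialDeriv i)^[3] (klOp L hL (isSmooth_truncField s ε N (embed s ε v))) ξ,
          (Torus.partialDeriv i)^[3] (truncField s ε N (embed s ε v)) ξ⟫_ℝ) +
      ε ^ 2 * ((∫ ξ, ⟪klOp L hL (isSmooth_truncField s ε N (embed s ε v)) ξ, truncField s ε N (embed s ε v) ξ⟫_ℝ) +
        ∑ i, ∫ ξ, ⟪(Torus.partialDeriv i)^[s] (klOp L hL (isSmooth_truncField s ε N (embed s ε v))) ξ,
          (Torus.partialDeriv i)^[s] (truncField s ε N (embed s ε v)) ξ⟫_ℝ) := by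
  set hU := isSmooth_truncField s ε N (embed s ε v)
  set U := truncField s ε N (embed s ε v) with hUdef
  have hA := isSmooth_klOp hL hU
  have hf : toSym s ε hU = embed s ε v := toSym_truncField_embed s ε hv
  -- coordinates of `v`: `v k = w(k)² • Û k`
  have hvk : ∀ k, v k = ((klWeight s ε k ^ 2 : ℝ) : ℂ) • mFourierCoeff (EuclideanSpace.complexify ∘ U) k := by
    intro k
    have h1 : embed s ε v k = ((klWeight s ε k : ℝ) : ℂ) • mFourierCoeff (EuclideanSpace.complexify ∘ U) k := by
      rw [← hf]; rfl
    rw [embed_apply] at h1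
    have hw : ((klWeight s ε k : ℝ) : ℂ) ≠ 0 := by exact_mod_cast (klWeight_pos s ε k).ne'
    have := congrArg (fun z => ((klWeight s ε k : ℝ) : ℂ) • z) h1
    simp only [smul_smul, mul_inv_cancel₀ hw, one_smul] at this
    rw [this]
    congr 1
    push_cast
    ring
  have h3 := hasSum_pureSq_mul_re_inner hA hU 3
  have hs' := hasSum_pureSq_mul_re_inner hA hU s
  have hsum := h3.add (hs'.mul_left (ε ^ 2))
  have hinner := SymL2.hasSum_inner (toL2 hA) v
  refine hinner.unique (hsum.congr_fun fun k => ?_)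
  rw [hvk k, inner_smul_right, SymL2.ofSmooth_apply]
  simp only [Complex.ofReal_one, one_smul, klWeight_sq, RCLike.re_eq_complex_re, Complex.re_ofReal_mul]
  ring

end Form

/-! ### Coercivity -/

/-- `n³ ≤ (n² + 1)²`. [folklore] -/
theorem cube_le_sq_add_one_sq (n : ℝ) : n ^ 3 ≤ (n ^ 2 + 1) ^ 2 := by
  nlinarith [sq_nonneg (n ^ 2 - n / 2), sq_nonneg n]

/-- The majorant `β(r) = K (r⁺ + 1)²`. [cite: KatoLai1984, §5 (5.5)] -/
def klBeta (K : ℝ) (r : ℝ) : ℝ := K * (max r 0 + 1) ^ 2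

/-- `β` is monotone for `K ≥ 0`. [folklore] -/
theorem monotone_klBeta {K : ℝ} (hK : 0 ≤ K) : Monotone (klBeta K) := by
  intro a b hab
  unfold klBeta
  have h1 : max a 0 ≤ max b 0 := max_le_max hab le_rfl
  have h2 : 0 ≤ max a 0 := le_max_right _ _
  exact mul_le_mul_of_nonneg_left (pow_le_pow_left₀ (by linarith) (by linarith) 2) hK

/-- `β ≥ 0` for `K ≥ 0`. [folklore] -/
theorem klBeta_nonneg {K : ℝ} (hK : 0 ≤ K) (r : ℝ) : 0 ≤ klBeta K r := by unfold klBeta; positivity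

section Coercive

variable {L : ℝ} (hL : 0 < L) {s : ℕ} (hs : 3 ≤ s)
include hs

/-- **Coercivity (5.5) on finitely supported test elements**, uniformly in `ε`:
`|⟪𝒜̂ (i v), v⟫| ≤ K ‖i v‖³` for `v = trunc N v`. [cite: KatoLai1984, §5 (5.5)] -/
theorem exists_abs_klForm_le_trunc : ∃ K : ℝ, 0 ≤ K ∧ ∀ (ε : ℝ) (t : ℝ) (N : ℕ) (v : SymL2 (Fin 3)),
    SymL2.trunc N v = v → |klForm hL s ε t (embed s ε v) v| ≤ K * ‖embed s ε v‖ ^ 3 := by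
  obtain ⟨K₃, hK₃0, hK₃⟩ := exists_abs_pairing_klOp_le hL (m := 3) le_rfl
  obtain ⟨Ks, hKs0, hKs⟩ := exists_abs_pairing_klOp_le hL (m := s) hs
  refine ⟨128 * K₃ + 8 * 4 ^ (s - 1) * Ks, by positivity, fun ε t N v hv => ?_⟩
  have hU := isSmooth_truncField s ε N (embed s ε v)
  have hf : toSym s ε hU = embed s ε v := toSym_truncField_embed s ε hv
  have hE1 : klOpExt hL s ε (embed s ε v) = toL2 (isSmooth_klOp hL hU) := by
    have h := klOpExt_toSym hL s ε hU
    rwa [hf] at h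
  rw [klForm_apply, hE1, inner_toL2_klOp_eq_pairing hL s ε hv]
  set n := ‖embed s ε v‖
  have hn0 : 0 ≤ n := norm_nonneg _
  -- lattice energies of `Ũ` by `n`
  have h3 : Torus.latNormSq 3 (truncField s ε N (embed s ε v)) ≤ 16 * n ^ 2 := by
    have := latNormSq_three_le_norm_toSym_sq s ε hU; rwa [hf] at this
  have h0 : Torus.latNormSq 0 (truncField s ε N (embed s ε v)) ≤ 16 * n ^ 2 := (Torus.latNormSq_mono hU (by norm_num)).trans h3
  have hεs : ε ^ 2 * Torus.latNormSq s (truncField s ε N (embed s ε v)) ≤ 4 ^ (s - 1) * n ^ 2 := by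
    have h1s : 1 ≤ s := le_trans (by norm_num) hs
    have := sq_mul_latNormSq_le_norm_toSym_sq h1s ε hU; rwa [hf] at this
  have hε0 : ε ^ 2 * Torus.latNormSq 0 (truncField s ε N (embed s ε v)) ≤ 4 ^ (s - 1) * n ^ 2 :=
    (mul_le_mul_of_nonneg_left (Torus.latNormSq_mono hU (Nat.zero_le s)) (sq_nonneg _)).trans hεs
  have hsq : Real.sqrt (Torus.latNormSq 3 (truncField s ε N (embed s ε v))) ≤ 4 * n := by
    rw [show 4 * n = Real.sqrt ((4 * n) ^ 2) from (Real.sqrt_sq (by positivity)).symm]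
    exact Real.sqrt_le_sqrt (by nlinarith)
  have l0 := Torus.latNormSq_nonneg 0 (truncField s ε N (embed s ε v))
  have l3 := Torus.latNormSq_nonneg 3 (truncField s ε N (embed s ε v))
  have ls := Torus.latNormSq_nonneg s (truncField s ε N (embed s ε v))
  have hP3 := hK₃ _ hU
  have hPs := hKs _ hU
  have hsq0 := Real.sqrt_nonneg (Torus.latNormSq 3 (truncField s ε N (embed s ε v)))
  -- `|P₃| ≤ 128 K₃ n³`
  have hA : |(∫ ξ, ⟪klOp L hL hU ξ, truncField s ε N (embed s ε v) ξ⟫_ℝ) +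
      ∑ i, ∫ ξ, ⟪(Torus.partialDeriv i)^[3] (klOp L hL hU) ξ, (Torus.partialDeriv i)^[3] (truncField s ε N (embed s ε v)) ξ⟫_ℝ| ≤
      128 * K₃ * n ^ 3 := by
    calc _ ≤ K₃ * Real.sqrt (Torus.latNormSq 3 (truncField s ε N (embed s ε v))) *
          (Torus.latNormSq 0 (truncField s ε N (embed s ε v)) + Torus.latNormSq 3 (truncField s ε N (embed s ε v))) := hP3
      _ ≤ K₃ * (4 * n) * (16 * n ^ 2 + 16 * n ^ 2) :=
          mul_le_mul (mul_le_mul_of_nonneg_left hsq hK₃0) (add_le_add h0 h3) (by positivity) (by positivity)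
      _ = 128 * K₃ * n ^ 3 := by ring
  -- `ε² |P_s| ≤ 8·4^{s-1} K_s n³`
  have hB : |ε ^ 2 * ((∫ ξ, ⟪klOp L hL hU ξ, truncField s ε N (embed s ε v) ξ⟫_ℝ) +
      ∑ i, ∫ ξ, ⟪(Torus.partialDeriv i)^[s] (klOp L hL hU) ξ, (Torus.partialDeriv i)^[s] (truncField s ε N (embed s ε v)) ξ⟫_ℝ)| ≤
      8 * 4 ^ (s - 1) * Ks * n ^ 3 := by
    rw [abs_mul, abs_of_nonneg (sq_nonneg ε)]
    calc _ ≤ ε ^ 2 * (Ks * Real.sqrt (Torus.latNormSq 3 (truncField s ε N (embed s ε v))) *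
          (Torus.latNormSq 0 (truncField s ε N (embed s ε v)) + Torus.latNormSq s (truncField s ε N (embed s ε v)))) :=
          mul_le_mul_of_nonneg_left hPs (sq_nonneg _)
      _ = Ks * Real.sqrt (Torus.latNormSq 3 (truncField s ε N (embed s ε v))) *
          (ε ^ 2 * Torus.latNormSq 0 (truncField s ε N (embed s ε v)) + ε ^ 2 * Torus.latNormSq s (truncField s ε N (embed s ε v))) := by
          ring
      _ ≤ Ks * (4 * n) * (4 ^ (s - 1) * n ^ 2 + 4 ^ (s - 1) * n ^ 2) :=
          mul_le_mul (mul_le_mul_of_nonneg_left hsq hKs0) (add_le_add hε0 hεs) (by positivity) (by positivity)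
      _ = 8 * 4 ^ (s - 1) * Ks * n ^ 3 := by ring
  calc _ ≤ 128 * K₃ * n ^ 3 + 8 * 4 ^ (s - 1) * Ks * n ^ 3 := (abs_add_le _ _).trans (add_le_add hA hB)
    _ = (128 * K₃ + 8 * 4 ^ (s - 1) * Ks) * n ^ 3 := by ring

/-- **Coercivity (5.5)** for all test elements, by density. [cite: KatoLai1984, §5 (5.5)] -/
theorem exists_abs_klForm_le : ∃ K : ℝ, 0 ≤ K ∧ ∀ (ε : ℝ) (t : ℝ) (v : SymL2 (Fin 3)),
    |klForm hL s ε t (embed s ε v) v| ≤ K * ‖embed s ε v‖ ^ 3 := by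
  obtain ⟨K, hK0, hK⟩ := exists_abs_klForm_le_trunc hL hs
  refine ⟨K, hK0, fun ε t v => ?_⟩
  have hF : Continuous fun g : SymL2 (Fin 3) => |klForm hL s ε t (embed s ε g) g| := by
    simp only [klForm_apply]
    exact (((continuous_klOpExt hL s ε).comp (embed s ε).continuous).inner continuous_id).abs
  have hG : Continuous fun g : SymL2 (Fin 3) => K * ‖embed s ε g‖ ^ 3 := ((embed s ε).continuous.norm.pow 3).const_mul K
  have ht := SymL2.tendsto_trunc v
  refine le_of_tendsto_of_tendsto' ((hF.tendsto v).comp ht) ((hG.tendsto v).comp ht) fun N => ?_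
  exact hK ε t N (SymL2.trunc N v) (trunc_trunc N v)

/-- **The coercivity hypothesis of Theorem A**: `-β(‖i v‖²) ≤ B t (i v) v`. [cite: KatoLai1984, §5 (5.5)] -/
theorem exists_klBeta_coercive : ∃ K : ℝ, 0 ≤ K ∧ ∀ (ε : ℝ) (t : ℝ) (v : SymL2 (Fin 3)),
    -klBeta K (‖embed s ε v‖ ^ 2) ≤ klForm hL s ε t (embed s ε v) v := by
  obtain ⟨K, hK0, hK⟩ := exists_abs_klForm_le hL hs
  refine ⟨K, hK0, fun ε t v => ?_⟩
  have h := hK ε t v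
  have hn := norm_nonneg (embed s ε v)
  have hc := cube_le_sq_add_one_sq ‖embed s ε v‖
  have hβ : K * ‖embed s ε v‖ ^ 3 ≤ klBeta K (‖embed s ε v‖ ^ 2) := by
    unfold klBeta
    rw [max_eq_left (sq_nonneg _)]
    exact mul_le_mul_of_nonneg_left hc hK0
  have := neg_abs_le (klForm hL s ε t (embed s ε v) v)
  linarith

/-- **The run of Theorem A** (Kato–Lai's abstract existence theorem, supersolution form, with
the affine supersolution `p(t) = M' + C t`, `C = 2β(M' + 1) + 1`): for every `ε` and every datum
`φ` with `‖φ‖² ≤ M'` there is a solution in duality form on `[0, T]`, `T = C⁻¹ = (2K(M'+2)² + 1)⁻¹`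
depending only on `L, s, M'`, with `‖u t‖² ≤ M' + 1`. [cite: KatoLai1984, §3 Thm A, §5] -/
theorem exists_formSolution_klForm : ∃ K : ℝ, 0 ≤ K ∧ ∀ (ε : ℝ) (M' : ℝ), 0 ≤ M' →
    ∀ φ : SymL2 (Fin 3), ‖φ‖ ^ 2 ≤ M' →
      ∃ u : ℝ → SymL2 (Fin 3), KatoLai.IsFormSolution (embed s ε) (klForm hL s ε) φ (2 * K * (M' + 2) ^ 2 + 1)⁻¹ u ∧
        ∀ t ∈ Set.Icc 0 (2 * K * (M' + 2) ^ 2 + 1)⁻¹, ‖u t‖ ^ 2 ≤ M' + 1 := by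
  obtain ⟨K, hK0, hK⟩ := exists_klBeta_coercive hL hs
  refine ⟨K, hK0, fun ε M' hM' φ hφ => ?_⟩
  set C : ℝ := 2 * K * (M' + 2) ^ 2 + 1 with hC
  have hCβ : C = 2 * klBeta K (M' + 1) + 1 := by
    rw [hC, klBeta, max_eq_left (by linarith)]; ring
  have hCpos : 0 < C := by positivity
  set T : ℝ := C⁻¹ with hT
  have hTpos : 0 < T := inv_pos.2 hCpos
  set i := embed s ε with hi
  set 𝒯 := KatoLai.AdmissibleTriplet.ofDenseInclusion i (embed_injective s ε) (denseRange_embed s ε) with h𝒯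
  have hA : KatoLai.IsSeqWeaklyContinuousOn (Set.Icc 0 T) (KatoLai.riesz (klForm hL s ε)) :=
    KatoLai.isSeqWeaklyContinuousOn_riesz (isSeqWeaklyContinuousFormOn_klForm hL s ε (Set.Icc 0 T))
  have hcoer : ∀ t ∈ Set.Icc 0 T, ∀ v : SymL2 (Fin 3),
      -klBeta K (‖𝒯.inclVH v‖ ^ 2) ≤ 𝒯.pairing v (KatoLai.riesz (klForm hL s ε) t (𝒯.inclVH v)) := by
    intro t _ v
    simp only [h𝒯, KatoLai.AdmissibleTriplet.ofDenseInclusion_inclVH, KatoLai.AdmissibleTriplet.ofDenseInclusion_pairing,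
      KatoLai.inner_riesz]
    exact hK ε t v
  set p : ℝ → ℝ := fun t => M' + C * t with hpdef
  have hp : ∀ t ∈ Set.Icc 0 T, HasDerivWithinAt p C (Set.Icc 0 T) t := fun t _ => by
    have h1 : HasDerivAt (fun r : ℝ => C * r) (C * 1) t := (hasDerivAt_id t).const_mul C
    rw [mul_one] at h1
    exact (h1.const_add M').hasDerivWithinAt
  have hp0 : ‖φ‖ ^ 2 ≤ p 0 := by
    show ‖φ‖ ^ 2 ≤ M' + C * 0
    rw [mul_zero, add_zero]
    exact hφ
  have hsuper : ∀ t ∈ Set.Icc 0 T, 2 * klBeta K (p t) < C := fun t ht => by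
    have hpt : p t ≤ M' + 1 := by
      have h1 : C * t ≤ C * C⁻¹ := mul_le_mul_of_nonneg_left ht.2 hCpos.le
      rw [mul_inv_cancel₀ hCpos.ne'] at h1
      show M' + C * t ≤ M' + 1
      linarith
    have h2 : klBeta K (p t) ≤ klBeta K (M' + 1) := monotone_klBeta hK0 hpt
    linarith
  obtain ⟨u, hu, hbound⟩ := KatoLai1984_thmA_holds (SymL2 (Fin 3)) (SymL2 (Fin 3)) (SymL2 (Fin 3)) 𝒯 T
    (KatoLai.riesz (klForm hL s ε)) (klBeta K) hA (monotone_klBeta hK0) (klBeta_nonneg hK0) hcoer φ T hTpos le_rfl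
    p (fun _ => C) hp hp0 hsuper
  refine ⟨u, KatoLai.IsFormSolution.of_isSolution (embed_injective s ε) (denseRange_embed s ε) hu, fun t ht => ?_⟩
  have h1 := hbound t ht
  have hpt : p t ≤ M' + 1 := by
    have h2 : C * t ≤ C * C⁻¹ := mul_le_mul_of_nonneg_left ht.2 hCpos.le
    rw [mul_inv_cancel₀ hCpos.ne'] at h2
    show M' + C * t ≤ M' + 1
    linarith
  exact h1.trans hpt

end Coercive

end PeriodicCylinder

end Literature.Analysis.FluidPDE
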